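import Summits.Ventures.Crystal3D.Theorems.StickyWulffConstantPolycrystalWulffBoundAggCertCheck

/-!
# `PolycrystalWulffBound`, line `PolyDensity`: soundness of the certificate checker, part A (rows versus their lower bounds)

Route `StickyWulffConstant` of the venture `Summits/Ventures/Crystal3D`, crux `PolycrystalWulffBound`
(item `stmt-Ventures-19482`), second prover lane (poly-p2, gen 7).  Real-valued shadows of the checker quantities —
`Φ` (power and `S` kinds, `phiR`) and `Γ` (coefficient of `κ`: recolour and delete kinds, `gamR`), the term sums,
the aggregated right-hand side (`termsRhsR_eq`) and its bound by `max(1,γ')·E` when every primal variable is bounded by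
`E` (`rhs_le_gamma`), and the key pointwise inequality `Φ + κ·Γ ≤` (true left-hand side) on the chamber part of a box
(`lhs_ge_phi_gam`: monotonicity of `x^{2/3}`, the two `S`-minorants, `qK ≤ 3K^{1/3}`).
WHAT THIS IS NOT: the barycentric step and the leaf theorem (part B); F-C1 not moved.
-/

noncomputable section

namespace Summit.Ventures.Crystal3D.Theorems

open Finset
open Summit.Ventures.Crystal3D.Cruxes.PolycrystalWulffBound.PolyDensity (AggCert27_8)

/-! ### Soundness of the leaf test -/

/-- `qK k ≥ 0`. -/
theorem qK_nonneg (k : Fin 13) : (0 : ℚ) ≤ qK k := by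
  fin_cases k <;> simp only [qK] <;> norm_num

/-- `0 ≤ KMAXQ`. -/
theorem KMAXQ_nonneg : (0 : ℚ) ≤ KMAXQ := by unfold KMAXQ; norm_num

/-- The kept form is the original one or its `t`-less part. -/
theorem QBox.minor_spec (B : QBox) (f g : Fin 15) (h : B.minor f = some g) : g = f ∨ aggLdrop f = some g := by
  unfold QBox.minor at h
  split_ifs at h with hc
  · left; exact (Option.some.inj h).symm
  · right; exact h

/-- Real-valued `Φ`-part of one unit of a row (power and `S` kinds). -/
def phiR (B : QBox) (l : AggLhs) (v : Bool) (x1 x2 x3 : ℝ) : ℝ :=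
  match l, v with
  | .pow k f, _ => match B.minor f with
    | some g => (qK k : ℝ) * aggL g x1 x2 x3 ^ ((2 : ℝ) / 3)
    | none => 0
  | .sum k, true => match B.minor 3 with
    | some g => (qK k : ℝ) * aggL g x1 x2 x3 ^ ((2 : ℝ) / 3)
    | none => 0
  | .sum k, false => (qK k : ℝ) * (B.cB : ℝ) * aggL 3 x1 x2 x3
  | .recol, _ => 0
  | .del _, _ => 0
  | .zero, _ => 0

/-- Real-valued `Γ`-part (coefficient of `κ`) of one unit of a row (recolour and delete kinds). -/
def gamR (B : QBox) (l : AggLhs) (x1 x2 x3 : ℝ) : ℝ :=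
  match l with
  | .recol => 1
  | .del f => match B.minor f with
    | some g => aggL g x1 x2 x3 ^ ((2 : ℝ) / 3)
    | none => 0
  | _ => 0

/-- `Σ y·Φ` over the terms. -/
def termsPhi (B : QBox) : List Term → ℝ → ℝ → ℝ → ℝ
  | [], _, _, _ => 0
  | (r, v, y) :: ts, x1, x2, x3 => (y : ℝ) * phiR B (aggRow r).lhs v x1 x2 x3 + termsPhi B ts x1 x2 x3

/-- `Σ y·Γ` over the terms. -/
def termsGam (B : QBox) : List Term → ℝ → ℝ → ℝ → ℝ
  | [], _, _, _ => 0
  | (r, _, y) :: ts, x1, x2, x3 => (y : ℝ) * gamR B (aggRow r).lhs x1 x2 x3 + termsGam B ts x1 x2 x3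

/-- `Σ y·(true left-hand side)` over the terms. -/
def termsLhs : List Term → ℝ → ℝ → ℝ → ℝ → ℝ → ℝ
  | [], _, _, _, _, _ => 0
  | (r, _, y) :: ts, x1, x2, x3, S, κ => (y : ℝ) * (aggRow r).lhs.val x1 x2 x3 S κ + termsLhs ts x1 x2 x3 S κ

/-- `Σ y·(right-hand side)` over the terms. -/
def termsRhsR (ts : List Term) (E F1 F2 F3 FR Y1 Y2 Y3 YR A12 A13 A1R A23 A2R A3R ARR : ℝ) : ℝ :=
  match ts with
  | [] => 0
  | (r, _, y) :: ts => (y : ℝ) * (aggRow r).rhs E F1 F2 F3 FR Y1 Y2 Y3 YR A12 A13 A1R A23 A2R A3R ARR +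
      termsRhsR ts E F1 F2 F3 FR Y1 Y2 Y3 YR A12 A13 A1R A23 A2R A3R ARR

/-- The aggregated right-hand side equals the right-hand side of the aggregated coefficients. -/
theorem termsRhsR_eq (ts : List Term) (E F1 F2 F3 FR Y1 Y2 Y3 YR A12 A13 A1R A23 A2R A3R ARR : ℝ) :
    termsRhsR ts E F1 F2 F3 FR Y1 Y2 Y3 YR A12 A13 A1R A23 A2R A3R ARR =
      (termsRhs ts).rhs E F1 F2 F3 FR Y1 Y2 Y3 YR A12 A13 A1R A23 A2R A3R ARR := by
  induction ts with
  | nil => simp [termsRhsR, termsRhs, AggRow.rhs]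
  | cons t ts ih =>
    obtain ⟨r, v, y⟩ := t
    simp only [termsRhsR, termsRhs, AggRow.rhs, ih]
    push_cast
    ring

/-- One coefficient against a bounded primal variable: `c·P ≤ k·(max(0,c)·E)`. -/
theorem coef_mul_le {c : ℚ} {P k E : ℝ} (hP : 0 ≤ P) (hPE : P ≤ k * E) :
    (c : ℝ) * P ≤ k * (((max 0 c : ℚ) : ℝ) * E) := by
  rcases le_or_gt c 0 with hc | hc
  · rw [max_eq_left hc]
    have hc' : (c : ℝ) ≤ 0 := by exact_mod_cast hc
    push_cast
    nlinarith [mul_nonneg (neg_nonneg.2 hc') hP, le_trans hP hPE]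
  · rw [max_eq_right hc.le]
    have hc' : (0 : ℝ) ≤ c := by exact_mod_cast hc.le
    nlinarith [mul_le_mul_of_nonneg_left hPE hc']

/-- The aggregated right-hand side is at most `max(1, γ')·E`. -/
theorem rhs_le_gamma (c : AggRow) {E F1 F2 F3 FR Y1 Y2 Y3 YR A12 A13 A1R A23 A2R A3R ARR : ℝ}
    (hE : 0 ≤ E) (hF1 : 0 ≤ F1) (hF2 : 0 ≤ F2) (hF3 : 0 ≤ F3) (hFR : 0 ≤ FR) (hY1 : 0 ≤ Y1) (hY2 : 0 ≤ Y2)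
    (hY3 : 0 ≤ Y3) (hYR : 0 ≤ YR) (hA12 : 0 ≤ A12) (hA13 : 0 ≤ A13) (hA1R : 0 ≤ A1R) (hA23 : 0 ≤ A23)
    (hA2R : 0 ≤ A2R) (hA3R : 0 ≤ A3R) (hARR : 0 ≤ ARR)
    (bF1 : F1 ≤ E) (bF2 : F2 ≤ E) (bF3 : F3 ≤ E) (bFR : FR ≤ E) (bY1 : Y1 ≤ 20000 / 34641 * E)
    (bY2 : Y2 ≤ 20000 / 34641 * E) (bY3 : Y3 ≤ 20000 / 34641 * E) (bYR : YR ≤ 20000 / 34641 * E) (bA12 : A12 ≤ E)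
    (bA13 : A13 ≤ E) (bA1R : A1R ≤ E) (bA23 : A23 ≤ E) (bA2R : A2R ≤ E) (bA3R : A3R ≤ E) (bARR : ARR ≤ E) :
    c.rhs E F1 F2 F3 FR Y1 Y2 Y3 YR A12 A13 A1R A23 A2R A3R ARR ≤ ((max 1 (gammaOf c) : ℚ) : ℝ) * E := by
  have e1 := coef_mul_le (c := c.cF1) hF1 (by linarith : F1 ≤ 1 * E)
  have e2 := coef_mul_le (c := c.cF2) hF2 (by linarith : F2 ≤ 1 * E)
  have e3 := coef_mul_le (c := c.cF3) hF3 (by linarith : F3 ≤ 1 * E)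
  have e4 := coef_mul_le (c := c.cFR) hFR (by linarith : FR ≤ 1 * E)
  have e5 := coef_mul_le (c := c.cY1) hY1 bY1
  have e6 := coef_mul_le (c := c.cY2) hY2 bY2
  have e7 := coef_mul_le (c := c.cY3) hY3 bY3
  have e8 := coef_mul_le (c := c.cYR) hYR bYR
  have e9 := coef_mul_le (c := c.cA12) hA12 (by linarith : A12 ≤ 1 * E)
  have e10 := coef_mul_le (c := c.cA13) hA13 (by linarith : A13 ≤ 1 * E)
  have e11 := coef_mul_le (c := c.cA1R) hA1R (by linarith : A1R ≤ 1 * E)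
  have e12 := coef_mul_le (c := c.cA23) hA23 (by linarith : A23 ≤ 1 * E)
  have e13 := coef_mul_le (c := c.cA2R) hA2R (by linarith : A2R ≤ 1 * E)
  have e14 := coef_mul_le (c := c.cA3R) hA3R (by linarith : A3R ≤ 1 * E)
  have e15 := coef_mul_le (c := c.cARR) hARR (by linarith : ARR ≤ 1 * E)
  have hmax : ((gammaOf c : ℚ) : ℝ) * E ≤ ((max 1 (gammaOf c) : ℚ) : ℝ) * E :=
    mul_le_mul_of_nonneg_right (by exact_mod_cast le_max_right _ _) hE
  refine le_trans ?_ hmax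
  have hγ : ((gammaOf c : ℚ) : ℝ) * E = (c.cE : ℝ) * E + 1 * (((max 0 c.cF1 : ℚ) : ℝ) * E) +
      1 * (((max 0 c.cF2 : ℚ) : ℝ) * E) + 1 * (((max 0 c.cF3 : ℚ) : ℝ) * E) + 1 * (((max 0 c.cFR : ℚ) : ℝ) * E) +
      20000 / 34641 * (((max 0 c.cY1 : ℚ) : ℝ) * E) + 20000 / 34641 * (((max 0 c.cY2 : ℚ) : ℝ) * E) +
      20000 / 34641 * (((max 0 c.cY3 : ℚ) : ℝ) * E) + 20000 / 34641 * (((max 0 c.cYR : ℚ) : ℝ) * E) +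
      1 * (((max 0 c.cA12 : ℚ) : ℝ) * E) + 1 * (((max 0 c.cA13 : ℚ) : ℝ) * E) + 1 * (((max 0 c.cA1R : ℚ) : ℝ) * E) +
      1 * (((max 0 c.cA23 : ℚ) : ℝ) * E) + 1 * (((max 0 c.cA2R : ℚ) : ℝ) * E) + 1 * (((max 0 c.cA3R : ℚ) : ℝ) * E) +
      1 * (((max 0 c.cARR : ℚ) : ℝ) * E) := by
    simp only [gammaOf, Rat.cast_add, Rat.cast_mul, Rat.cast_div, Rat.cast_ofNat]
    ring
  unfold AggRow.rhs
  linarith [e1, e2, e3, e4, e5, e6, e7, e8, e9, e10, e11, e12, e13, e14, e15, hγ]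

/-- Lower bound of the true left-hand sides by `Φ + κ·Γ`, term by term, on the chamber part of the box. -/
theorem lhs_ge_phi_gam (B : QBox) (l : AggLhs) (v : Bool) {x1 x2 x3 S κ : ℝ}
    (h1 : 0 ≤ x1) (h2 : 0 ≤ x2) (h3 : 0 ≤ x3) (ht : x1 + x2 + x3 ≤ 1) (hx3 : x3 ≤ B.b3)
    (hS : 0 ≤ S) (hκ : 0 ≤ κ)
    (hS1 : (1 - x1 - x2 - x3) ^ ((2 : ℝ) / 3) ≤ S)
    (hS2 : ∀ c : ℝ, 0 ≤ c → c ^ 3 * x3 ≤ 1 → (1 - x1 - x2 - x3) * c ≤ S) :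
    phiR B l v x1 x2 x3 + κ * gamR B l x1 x2 x3 ≤ l.val x1 x2 x3 S κ := by
  have hmin : ∀ f g, B.minor f = some g → 0 ≤ aggL g x1 x2 x3 ∧ aggL g x1 x2 x3 ≤ aggL f x1 x2 x3 := by
    intro f g hg
    refine ⟨aggL_nonneg g h1 h2 h3 ht, ?_⟩
    rcases B.minor_spec f g hg with rfl | hd
    · exact le_rfl
    · exact aggL_drop_le f g hd ht
  cases l with
  | pow k f =>
    simp only [phiR, gamR, AggLhs.val, mul_zero, add_zero]
    split
    · rename_i g hg
      obtain ⟨hg0, hgf⟩ := hmin f g hg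
      have hq := qK_le k
      have hpow : aggL g x1 x2 x3 ^ ((2 : ℝ) / 3) ≤ aggL f x1 x2 x3 ^ ((2 : ℝ) / 3) :=
        Real.rpow_le_rpow hg0 hgf (by norm_num)
      have hq0 : (0 : ℝ) ≤ qK k := by exact_mod_cast qK_nonneg k
      calc (qK k : ℝ) * aggL g x1 x2 x3 ^ ((2 : ℝ) / 3)
          ≤ (3 * aggK k ^ ((1 : ℝ) / 3)) * aggL g x1 x2 x3 ^ ((2 : ℝ) / 3) :=
            mul_le_mul_of_nonneg_right hq (Real.rpow_nonneg hg0 _)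
        _ ≤ (3 * aggK k ^ ((1 : ℝ) / 3)) * aggL f x1 x2 x3 ^ ((2 : ℝ) / 3) :=
            mul_le_mul_of_nonneg_left hpow (le_trans hq0 hq)
        _ = 3 * aggK k ^ ((1 : ℝ) / 3) * aggL f x1 x2 x3 ^ ((2 : ℝ) / 3) := by ring
    · have hq := qK_le k
      have hq0 : (0 : ℝ) ≤ qK k := by exact_mod_cast qK_nonneg k
      exact mul_nonneg (le_trans hq0 hq) (Real.rpow_nonneg (aggL_nonneg f h1 h2 h3 ht) _)
  | sum k =>
    cases v with
    | true =>
      simp only [phiR, gamR, AggLhs.val, mul_zero, add_zero]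
      split
      · rename_i g hg
        obtain ⟨hg0, hgf⟩ := hmin 3 g hg
        have hq := qK_le k
        have hq0 : (0 : ℝ) ≤ qK k := by exact_mod_cast qK_nonneg k
        have ht3 : aggL g x1 x2 x3 ^ ((2 : ℝ) / 3) ≤ S := by
          refine le_trans (Real.rpow_le_rpow hg0 hgf (by norm_num)) ?_
          simpa only [aggL] using hS1
        calc (qK k : ℝ) * aggL g x1 x2 x3 ^ ((2 : ℝ) / 3) ≤ (3 * aggK k ^ ((1 : ℝ) / 3)) * S :=
              mul_le_mul hq ht3 (Real.rpow_nonneg hg0 _) (le_trans hq0 hq)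
          _ = 3 * aggK k ^ ((1 : ℝ) / 3) * S := by ring
      · have hq := qK_le k
        have hq0 : (0 : ℝ) ≤ qK k := by exact_mod_cast qK_nonneg k
        nlinarith [mul_nonneg (le_trans hq0 hq) hS]
    | false =>
      simp only [phiR, gamR, AggLhs.val, mul_zero, add_zero]
      have hq := qK_le k
      have hq0 : (0 : ℝ) ≤ qK k := by exact_mod_cast qK_nonneg k
      have hc0 : (0 : ℝ) ≤ B.cB := by exact_mod_cast B.cB_nonneg
      have hc3 : (B.cB : ℝ) ^ 3 * x3 ≤ 1 := by
        have h := B.cB_pow_mul_le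
        have h' : ((B.cB : ℚ) : ℝ) ^ 3 * (B.b3 : ℝ) ≤ 1 := by exact_mod_cast h
        nlinarith [pow_nonneg hc0 3]
      have hlin : aggL 3 x1 x2 x3 * (B.cB : ℝ) ≤ S := by
        simpa only [aggL] using hS2 (B.cB : ℝ) hc0 hc3
      calc (qK k : ℝ) * (B.cB : ℝ) * aggL 3 x1 x2 x3 = (qK k : ℝ) * (aggL 3 x1 x2 x3 * (B.cB : ℝ)) := by ring
        _ ≤ (3 * aggK k ^ ((1 : ℝ) / 3)) * S := mul_le_mul hq hlin (by
            nlinarith [aggL_nonneg 3 h1 h2 h3 ht]) (le_trans hq0 hq)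
        _ = 3 * aggK k ^ ((1 : ℝ) / 3) * S := by ring
  | recol => simp [phiR, gamR, AggLhs.val]
  | del f =>
    simp only [phiR, gamR, AggLhs.val, zero_add]
    split
    · rename_i g hg
      obtain ⟨hg0, hgf⟩ := hmin f g hg
      exact mul_le_mul_of_nonneg_left (Real.rpow_le_rpow hg0 hgf (by norm_num)) hκ
    · simp only [mul_zero]
      exact mul_nonneg hκ (Real.rpow_nonneg (aggL_nonneg f h1 h2 h3 ht) _)
  | zero => simp [phiR, gamR, AggLhs.val]


end Summit.Ventures.Crystal3D.Theorems

end
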